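import Summits.QuantumFields.YangMills.Theorems.LuscherReductionTwistedTraceScalingColourAverage
import Summits.QuantumFields.YangMills.Theorems.LuscherReductionTwistedTraceScalingRecordWeightRho
import Summits.QuantumFields.YangMills.Theorems.LuscherReductionRunningReductionCoarseUpperCopies
import Summits.QuantumFields.YangMills.Theorems.LuscherReductionRunningReductionKTDoor
import HarnessLib

/-!
# FLOOR glue in tube currency: `T(f₀) ≤ (λ₀(β,L) + 7·crossBound)·‖f₀‖²_{N/χ}` for EVERY tube function `f₀` supported in `supp χ ∩ {orbitDist < δ}`
# (lane A of S-BASE, crux `TwistedTraceScaling` stmt-QuantumFields-20203, C4 INNER; design note `pub/ym-fleet/ym-luscher-20007-p1/COARSE-DESIGN.md` §24.4 (FL))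

The FLOOR clause of the Born–Oppenheimer package (`e^{−ελ_b/4}σμ₀(L³β) ≤ λ₀(β,L)`) is a LOWER bound on the lattice top value; in tube currency it is supplied by any single tube
function whose tube Rayleigh quotient is large.  THIS FILE proves the glue, for an arbitrary bounded measurable `f₀` vanishing off `supp χ` (`χ ≥ 0` bounded measurable with
`χ ≥ c > 0` on its support):
* ★ `sq_gaugeAvg_le` — the Faddeev–Popov Cauchy–Schwarz inequality `(gaugeAvg f₀)² ≤ gaugeAvg (f₀²/χ) · gaugeAvg χ` pointwise (discriminant of `t ↦ ∫ (f₀/χ − t)²χ dg ≥ 0`);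
* ★ `l2_gaugeAvg_le_tubeNormSq` — `‖gaugeAvg f₀‖² ≤ ∫ f₀²·(N/χ) = tubeNormSq (softWeight χ) f₀` (`∫ gaugeAvg(·)·N = ∫ (·)·N`, `N` invariant);
* ★ `qform_gaugeAvg_eq_tubeForm` — `⟨gaugeAvg f₀, K_β gaugeAvg f₀⟩ = tubeForm β f₀` (`K_β ∘ gaugeAvg = gaugeAvg ∘ K_β` + the averaging engine + `gaugeAvg (K f)(U) = ∫ K̃(U,V)f(V)dV`);
* ★★ `tubeForm_le_levelValue_zero` — if moreover `f₀` is supported in `{orbitDist < δ}` with `L(δ + m) < 2`, `m ≥ 0`, `β ≥ 1… > 0`: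
  `tubeForm β f₀ ≤ (levelValue su2Rep L β 0 + 7·crossBound L β m) · tubeNormSq (softWeight χ) f₀` (twist-symmetrise `gaugeAvg f₀` — a physical function — and use the
  variational definition of `λ₀` with the eight-copies calculus).  With `crossBound_eventually_small` the `7·crossBound` is `≤ (ε/4)λ_b·λ₀` eventually.
HONEST FRAMING: bookkeeping for a stub of a child of the CONDITIONAL reduction route R2b1; the FLOOR itself needs the trial function of (F)+(OS0); C4 OPEN; not a gap, not Clay.
-/

set_option autoImplicit false

noncomputable section

open MeasureTheory Filter Topology Real
open scoped BigOperators
open Literature.MathematicalPhysics.QuantumFieldTheory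
open Literature.MathematicalPhysics.QuantumLattice

namespace Summit.QuantumFields.YangMills.Theorems.FemtoTransferGap.TwoLattice.Avg

open Summit.QuantumFields.YangMills.Theorems.FemtoTransferGap

variable {L : ℕ} [NeZero L]

/-! ## §1 The Faddeev–Popov Cauchy–Schwarz inequality -/

/-- Discriminant form of Cauchy–Schwarz on a probability space: for bounded measurable `F` and a bounded measurable weight `w ≥ 0`,
`(∫ F·w)² ≤ (∫ F²·w)·(∫ w)`. [folklore] -/
theorem sq_integral_mul_le {Ω : Type*} [MeasurableSpace Ω] (μ : Measure Ω) [IsProbabilityMeasure μ] {F w : Ω → ℝ} (hF : Measurable F) (hw : Measurable w)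
    {CF Cw : ℝ} (hCF : ∀ x, |F x| ≤ CF) (hCw : ∀ x, |w x| ≤ Cw) (hw0 : ∀ x, 0 ≤ w x) :
    (∫ x, F x * w x ∂μ) ^ 2 ≤ (∫ x, F x ^ 2 * w x ∂μ) * ∫ x, w x ∂μ := by
  -- integrability of the three pieces
  have hiw : Integrable w μ := integrable_of_measurable_abs_le _ hw hCw
  have hiFw : Integrable (fun x => F x * w x) μ :=
    integrable_of_measurable_abs_le _ (hF.mul hw) (C := CF * Cw) fun x => by
      rw [abs_mul]; exact mul_le_mul (hCF x) (hCw x) (abs_nonneg _) ((abs_nonneg _).trans (hCF x))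
  have hiF2w : Integrable (fun x => F x ^ 2 * w x) μ :=
    integrable_of_measurable_abs_le _ ((hF.pow_const 2).mul hw) (C := CF ^ 2 * Cw) fun x => by
      rw [abs_mul, abs_pow]; exact mul_le_mul (pow_le_pow_left₀ (abs_nonneg _) (hCF x) 2) (hCw x) (abs_nonneg _) (sq_nonneg _)
  -- `t ↦ ∫ (F − t)² w = (∫w) t² − 2(∫Fw) t + ∫F²w ≥ 0`
  have hquad : ∀ t : ℝ, 0 ≤ (∫ x, w x ∂μ) * (t * t) + (-(2 * ∫ x, F x * w x ∂μ)) * t + ∫ x, F x ^ 2 * w x ∂μ := by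
    intro t
    have h0 : 0 ≤ ∫ x, (F x - t) ^ 2 * w x ∂μ := integral_nonneg fun x => mul_nonneg (sq_nonneg _) (hw0 x)
    have he : ∫ x, (F x - t) ^ 2 * w x ∂μ = (∫ x, F x ^ 2 * w x ∂μ) - 2 * t * (∫ x, F x * w x ∂μ) + t ^ 2 * ∫ x, w x ∂μ := by
      have e1 : ∫ x, (F x - t) ^ 2 * w x ∂μ = ∫ x, ((F x ^ 2 * w x - (2 * t) * (F x * w x)) + t ^ 2 * w x) ∂μ :=
        integral_congr_ae (ae_of_all _ fun x => by ring)
      have hcm : Integrable (fun x => 2 * t * (F x * w x)) μ := hiFw.const_mul (2 * t)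
      have hsub : Integrable (fun x => F x ^ 2 * w x - 2 * t * (F x * w x)) μ := hiF2w.sub hcm
      have hcw : Integrable (fun x => t ^ 2 * w x) μ := hiw.const_mul (t ^ 2)
      rw [e1, integral_add hsub hcw, integral_sub hiF2w hcm, integral_const_mul, integral_const_mul]
    rw [he] at h0
    nlinarith [h0]
  have hd := discrim_le_zero hquad
  unfold discrim at hd
  nlinarith [hd]

/-- ★ **`(gaugeAvg f₀)² ≤ gaugeAvg (f₀²/χ) · gaugeAvg χ`** pointwise, for bounded measurable `f₀` vanishing off `supp χ` and a bounded measurable weight `χ ≥ 0` with `χ ≥ c > 0` on its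
support (so that `f₀/χ` is bounded). [cite: SeilerLNP1982, §2] -/
theorem sq_gaugeAvg_le {f₀ χ : GaugeConfig 3 L SU2 → ℝ} (hf : Measurable f₀) {Cf : ℝ} (hCf : ∀ U, |f₀ U| ≤ Cf) (hχ : Measurable χ) {Cχ : ℝ} (hCχ : ∀ U, |χ U| ≤ Cχ)
    (hχ0 : ∀ U, 0 ≤ χ U) {c : ℝ} (hc : 0 < c) (hcχ : ∀ U, χ U ≠ 0 → c ≤ χ U) (hsupp : ∀ U, χ U = 0 → f₀ U = 0) (U : GaugeConfig 3 L SU2) :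
    gaugeAvg f₀ U ^ 2 ≤ gaugeAvg (fun V => f₀ V ^ 2 / χ V) U * gaugeAvg χ U := by
  -- `F := f₀/χ`, bounded by `Cf/c`; `f₀ = F·χ` and `f₀²/χ = F²·χ` pointwise
  have hCf0 : 0 ≤ Cf := (abs_nonneg _).trans (hCf U)
  have hFb : ∀ V, |f₀ V / χ V| ≤ Cf / c := fun V => by
    by_cases h : χ V = 0
    · rw [h, div_zero, abs_zero]; positivity
    · rw [abs_div, abs_of_pos (hc.trans_le (hcχ V h))]
      exact div_le_div₀ hCf0 (hCf V) hc (hcχ V h)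
  have hid1 : ∀ V, f₀ V = f₀ V / χ V * χ V := fun V => by
    by_cases h : χ V = 0
    · rw [h, mul_zero, hsupp V h]
    · rw [div_mul_cancel₀ _ h]
  have hid2 : ∀ V, f₀ V ^ 2 / χ V = (f₀ V / χ V) ^ 2 * χ V := fun V => by
    by_cases h : χ V = 0
    · rw [h, div_zero, mul_zero]
    · field_simp
  unfold gaugeAvg
  have e1 : (fun g : Site 3 L → SU2 => f₀ (gaugeTransform g U)) = fun g => f₀ (gaugeTransform g U) / χ (gaugeTransform g U) * χ (gaugeTransform g U) :=
    funext fun g => hid1 _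
  have e2 : (fun g : Site 3 L → SU2 => f₀ (gaugeTransform g U) ^ 2 / χ (gaugeTransform g U)) =
      fun g => (f₀ (gaugeTransform g U) / χ (gaugeTransform g U)) ^ 2 * χ (gaugeTransform g U) := funext fun g => hid2 _
  rw [e1, e2]
  exact sq_integral_mul_le (gaugeMeasure L) ((measurable_comp_gaugeTransform_left hf U).div (measurable_comp_gaugeTransform_left hχ U))
    (measurable_comp_gaugeTransform_left hχ U) (fun g => hFb _) (fun g => hCχ _) (fun g => hχ0 _)

/-! ## §2 ★ The `L²` norm of a gauge average against the tube norm -/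

/-- ★ **`‖gaugeAvg f₀‖² ≤ ∫ f₀²·(N/χ)`** (`N = gaugeAvg χ`): integrate `sq_gaugeAvg_le` and move the average off `f₀²/χ` onto the invariant `N`. [cite: SeilerLNP1982, §2] -/
theorem l2_gaugeAvg_le_tubeNormSq {f₀ χ : GaugeConfig 3 L SU2 → ℝ} (hf : Measurable f₀) {Cf : ℝ} (hCf : ∀ U, |f₀ U| ≤ Cf) (hχ : Measurable χ) {Cχ : ℝ}
    (hCχ : ∀ U, |χ U| ≤ Cχ) (hχ0 : ∀ U, 0 ≤ χ U) {c : ℝ} (hc : 0 < c) (hcχ : ∀ U, χ U ≠ 0 → c ≤ χ U) (hsupp : ∀ U, χ U = 0 → f₀ U = 0) :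
    l2 (gaugeAvg f₀) (gaugeAvg f₀) ≤ tubeNormSq (softWeight χ) f₀ := by
  have hCf0 : 0 ≤ Cf := (abs_nonneg _).trans (hCf 1)
  have hCχ0 : 0 ≤ Cχ := (abs_nonneg _).trans (hCχ 1)
  -- the function `f₀²/χ` is bounded measurable
  have hqm : Measurable fun V => f₀ V ^ 2 / χ V := (hf.pow_const 2).div hχ
  have hqb : ∀ V, |f₀ V ^ 2 / χ V| ≤ Cf ^ 2 / c := fun V => by
    by_cases h : χ V = 0
    · rw [h, div_zero, abs_zero]; positivity
    · rw [abs_div, abs_of_pos (hc.trans_le (hcχ V h)), abs_pow]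
      exact div_le_div₀ (sq_nonneg _) (pow_le_pow_left₀ (abs_nonneg _) (hCf V) 2) hc (hcχ V h)
  have hNm : Measurable (gaugeAvg χ) := measurable_gaugeAvg hχ
  have hNb : ∀ U, |gaugeAvg χ U| ≤ Cχ := abs_gaugeAvg_le hχ hCχ
  have hNinv : ∀ (g : Site 3 L → SU2) (U : GaugeConfig 3 L SU2), gaugeAvg χ (gaugeTransform g U) = gaugeAvg χ U := fun g U => gaugeAvg_gaugeTransform χ g U
  -- pointwise and integrate
  have hpt : ∀ U, gaugeAvg f₀ U * gaugeAvg f₀ U ≤ gaugeAvg (fun V => f₀ V ^ 2 / χ V) U * gaugeAvg χ U := fun U => by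
    rw [← sq]; exact sq_gaugeAvg_le hf hCf hχ hCχ hχ0 hc hcχ hsupp U
  have hAm : Measurable (gaugeAvg f₀) := measurable_gaugeAvg hf
  have hAb : ∀ U, |gaugeAvg f₀ U| ≤ Cf := abs_gaugeAvg_le hf hCf
  unfold l2
  calc ∫ U, gaugeAvg f₀ U * gaugeAvg f₀ U ∂configMeasure SU2 L
      ≤ ∫ U, gaugeAvg (fun V => f₀ V ^ 2 / χ V) U * gaugeAvg χ U ∂configMeasure SU2 L := by
        refine integral_mono_of_nonneg (ae_of_all _ fun U => mul_self_nonneg _) ?_ (ae_of_all _ hpt)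
        exact integrable_of_measurable_abs_le _ ((measurable_gaugeAvg hqm).mul hNm) (C := Cf ^ 2 / c * Cχ) fun U => by
          rw [abs_mul]; exact mul_le_mul (abs_gaugeAvg_le hqm hqb U) (hNb U) (abs_nonneg _) (by positivity)
    _ = ∫ U, (f₀ U ^ 2 / χ U) * gaugeAvg χ U ∂configMeasure SU2 L := integral_gaugeAvg_mul_invariant hqm hqb hNm hNb hNinv
    _ = tubeNormSq (softWeight χ) f₀ := by
        unfold tubeNormSq softWeight
        refine integral_congr_ae (ae_of_all _ fun U => ?_)
        dsimp only
        by_cases h : χ U = 0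
        · rw [h, div_zero, div_zero, zero_mul, mul_zero]
        · rw [div_mul_eq_mul_div, mul_div_assoc]

/-! ## §3 ★ The transfer form of a gauge average is the tube form -/

/-- ★ **`⟨gaugeAvg f₀, K_β gaugeAvg f₀⟩ = tubeForm β f₀`** for bounded measurable `f₀`. [cite: SeilerLNP1982, §3] -/
theorem qform_gaugeAvg_eq_tubeForm (β : ℝ) {f₀ : GaugeConfig 3 L SU2 → ℝ} (hf : Measurable f₀) {Cf : ℝ} (hCf : ∀ U, |f₀ U| ≤ Cf) :
    qform su2Rep β (gaugeAvg f₀) (gaugeAvg f₀) = tubeForm β f₀ := by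
  haveI : SecondCountableTopology SU2 := secondCountableTopology_su2
  obtain ⟨M, hM⟩ := exists_transferKernel_le su2Rep continuous_su2Rep β (L := L)
  have hAm : Measurable (gaugeAvg f₀) := measurable_gaugeAvg hf
  have hAb : ∀ U, |gaugeAvg f₀ U| ≤ Cf := abs_gaugeAvg_le hf hCf
  -- `⟨Sf₀, K Sf₀⟩ = ∫ Sf₀ · (K Sf₀) = ∫ f₀ · (K Sf₀)` (`K Sf₀` is invariant) `= ∫ f₀ · S(K f₀) = ∫ f₀ (∫ K̃ f₀)`
  rw [qform_eq_l2_transferApply]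
  unfold l2
  have hKSm : Measurable (transferApply β (gaugeAvg f₀)) := measurable_transferApply β hAm
  have hKSb : ∀ U, |transferApply β (gaugeAvg f₀) U| ≤ M * Cf := abs_transferApply_le β hM hAm hAb
  have hKSinv : ∀ (g : Site 3 L → SU2) (U : GaugeConfig 3 L SU2), transferApply β (gaugeAvg f₀) (gaugeTransform g U) = transferApply β (gaugeAvg f₀) U :=
    fun g U => transferApply_gaugeTransform_of_invariant β hAm (fun g' V => gaugeAvg_gaugeTransform f₀ g' V) g U
  rw [integral_gaugeAvg_mul_invariant hf hCf hKSm hKSb hKSinv, tubeForm_eq_integral_mul]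
  refine integral_congr_ae (ae_of_all _ fun U => ?_)
  dsimp only
  rw [transferApply_gaugeAvg β hf hCf U, gaugeAvg_transferApply_eq_integral_avgKernel β hf hCf U]

/-! ## §4 ★★ The tube form against the lattice top value -/

/-- The gauge average of a function supported in `{orbitDist < δ}` is supported there. [folklore] -/
theorem orbitDist_lt_of_gaugeAvg_ne_zero {f₀ : GaugeConfig 3 L SU2 → ℝ} {δ : ℝ} (hsupp : ∀ U, f₀ U ≠ 0 → orbitDist U < δ) {U : GaugeConfig 3 L SU2}
    (hU : gaugeAvg f₀ U ≠ 0) : orbitDist U < δ := by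
  by_contra hlt
  apply hU
  unfold gaugeAvg
  have h : ∀ g : Site 3 L → SU2, f₀ (gaugeTransform g U) = 0 := fun g => by
    by_contra hne
    exact hlt (by rw [← orbitDist_gaugeTransform g U]; exact hsupp _ hne)
  simp [h]

/-- ★★ **TUBE FLOOR GLUE**: for `β ≥ 0`, `m ≥ 0`, `L(δ + m) < 2`, and a bounded measurable tube function `f₀` vanishing off `supp χ` and off `{orbitDist < δ}` (`χ ≥ 0` bounded
measurable, `χ ≥ c > 0` on its support): `tubeForm β f₀ ≤ (λ₀(β,L) + 7·crossBound L β m)·tubeNormSq (softWeight χ) f₀`. [cite: Luscher1983, §3] [cite: ReedSimonIV1978, Thm. XIII.1] -/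
theorem tubeForm_le_levelValue_zero {β : ℝ} (hβ : 0 ≤ β) {δ m : ℝ} (hm : 0 ≤ m) (hLδm : (L : ℝ) * (δ + m) < 2)
    {f₀ χ : GaugeConfig 3 L SU2 → ℝ} (hf : Measurable f₀) {Cf : ℝ} (hCf : ∀ U, |f₀ U| ≤ Cf) (hχ : Measurable χ) {Cχ : ℝ}
    (hCχ : ∀ U, |χ U| ≤ Cχ) (hχ0 : ∀ U, 0 ≤ χ U) {c : ℝ} (hc : 0 < c) (hcχ : ∀ U, χ U ≠ 0 → c ≤ χ U) (hsupp : ∀ U, χ U = 0 → f₀ U = 0)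
    (hsuppδ : ∀ U, f₀ U ≠ 0 → orbitDist U < δ) :
    tubeForm β f₀ ≤ (levelValue su2Rep L β 0 + 7 * crossBound L β m) * tubeNormSq (softWeight χ) f₀ := by
  set ψ : GaugeConfig 3 L SU2 → ℝ := gaugeAvg f₀ with hψdef
  have hψm : Measurable ψ := measurable_gaugeAvg hf
  have hψb : ∀ U, |ψ U| ≤ Cf := abs_gaugeAvg_le hf hCf
  have hψg : ∀ (g : Site 3 L → SU2) (U : GaugeConfig 3 L SU2), ψ (gaugeTransform g U) = ψ U := fun g U => gaugeAvg_gaugeTransform f₀ g U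
  have hψs : ∀ U, ψ U ≠ 0 → orbitDist U < δ := fun U hU => orbitDist_lt_of_gaugeAvg_ne_zero hsuppδ hU
  have hLδ : (L : ℝ) * δ < 2 := by have hL0 : (0 : ℝ) ≤ L := Nat.cast_nonneg L; nlinarith
  -- the physical function `twistSum ψ`
  have hphys : IsPhys (twistSum ψ) := isPhys_twistSum hψm ⟨Cf, hψb⟩ hψg
  have hn : l2 (twistSum ψ) (twistSum ψ) = 8 * l2 ψ ψ := l2_twistSum hψm hψb hLδ hψs
  have hq := abs_qform_twistSum_sub_le hβ hψm hψb hm hLδm hψs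
  rw [abs_le] at hq
  have hn0 : 0 ≤ l2 ψ ψ := l2_self_nonneg_lat _
  -- `qform (twistSum ψ) ≤ λ₀ ‖twistSum ψ‖²`
  have htop : qform su2Rep β (twistSum ψ) (twistSum ψ) ≤ levelValue su2Rep L β 0 * l2 (twistSum ψ) (twistSum ψ) := by
    by_cases hpos : 0 < l2 (twistSum ψ) (twistSum ψ)
    · exact qform_le_levelValue_zero_mul su2Rep continuous_su2Rep β hphys hpos
    · -- `‖twistSum ψ‖² = 0`: then `‖ψ‖² = 0`, `ψ = 0` a.e., and both forms vanish… we only need `qform ψ ≤ …`; use the crude kernel bound instead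
      have hz : l2 (twistSum ψ) (twistSum ψ) = 0 := le_antisymm (not_lt.mp hpos) (l2_self_nonneg_lat _)
      rw [hz, mul_zero, qform_eq_zero_of_l2_eq_zero β hphys hz]
  -- assemble: `tubeForm f₀ = qform ψ ≤ (λ₀ + 7 cB) ‖ψ‖² ≤ (λ₀ + 7 cB) ‖f₀‖²_w`
  have hT : tubeForm β f₀ = qform su2Rep β ψ ψ := (qform_gaugeAvg_eq_tubeForm β hf hCf).symm
  have hnorm : l2 ψ ψ ≤ tubeNormSq (softWeight χ) f₀ := l2_gaugeAvg_le_tubeNormSq hf hCf hχ hCχ hχ0 hc hcχ hsupp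
  have hlv0 : 0 ≤ levelValue su2Rep L β 0 := levelValue_su2Rep_nonneg L hβ 0
  have hcB : 0 ≤ crossBound L β m := (crossBound_pos β m).le
  rw [hT]
  rw [hn] at htop
  calc qform su2Rep β ψ ψ ≤ (levelValue su2Rep L β 0 + 7 * crossBound L β m) * l2 ψ ψ := by nlinarith [hq.1, htop]
    _ ≤ (levelValue su2Rep L β 0 + 7 * crossBound L β m) * tubeNormSq (softWeight χ) f₀ := mul_le_mul_of_nonneg_left hnorm (by positivity)

end Summit.QuantumFields.YangMills.Theorems.FemtoTransferGap.TwoLattice.Avg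

end
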